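import Summits.QuantumFields.YangMills.Theorems.BalabanUVNodesN21TransversalGibbsHazard

/-!
# N21 (NE7c) · the dependent hazard principle WITH A DEFECT EVENT — (M1) for the block-sup of CROSS-DEPENDENT,
# transversally-read Gibbs variables up to a «double-shell» defect

R134 seat pub-ymgap-dag-n21-d (g8), node N21 = NE7c (single-run shell-weight bound, NOT PRINTED in [Bałaban 1983–89],
NOT proved), lane K3⁷ `SpineGivenEndpointR13SepCoPH` (stmt-QuantumFields-20544, `--kind proof --supports … --as helper`).
Part 12 of the comparison series; consumes parts 7–10 (`…N21FirstExceedanceHazard`, `…N21HazardFromLogLipschitz`,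
`…N21GibbsBlockSupHazard`, `…N21TransversalGibbsHazard`).

WHAT THIS FILE IS.  Parts 9–10 verified part 7's CONDITIONAL hazard hypothesis fibrewise, using that the sub-level
events of the OTHER tested variables do not read the fibre coordinate.  When a tested variable reads SEVERAL
coordinates (the minimiser couples them) this fails: moving along `p`'s fibre may push another variable `u_q` across its
threshold, i.e. the fibre EXITS the conditioning event.  This file types the remedy as a principle with a DEFECT:
* §1 (abstract, any measure, any variables).  If each variable satisfies the conditional windowed hazard bound UP TO A
  DEFECT carried by a fixed measurable event `B` on its first-exceedance event,
  `ν(slice(p,s)) ≤ c·ν({a ≤ v p} ∩ C(p,s)) + ν({a ≤ v p} ∩ {v q < a, q ∈ s} ∩ B)`, then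
  `ν{a ≤ ⨆ v < b} ≤ c·ν{a ≤ ⨆ v} + ν({a ≤ ⨆ v} ∩ B)` (`measure_shell_iSup_le_of_condHazard_defect`) — the
  first-exceedance events are disjoint, so the defects add up inside `{a ≤ ⨆ v} ∩ B` ONCE, whatever the number of
  variables.  Part 7's principle is the case `B = ∅`.
* §2 (Tonelli, general).  `measure_le_of_fibrewise`: on `ℝ^ι` with density `g`, a fibrewise domination
  `∫_{fibre ∩ S} g ≤ c ∫_{fibre ∩ F} g` along every `p`-fibre gives `ν S ≤ c·ν F` for ANY measurable `S, F` (part 9 §1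
  is the case of sets not reading `x_p`).
* §3 (the fibre with exit).  For a tested variable `w` read transversally along `x_p` (slope `≥ κ`), a density
  non-collapsing by `M` within `δ` to the right at shell points, a conditioning event `C` (which MAY read `x_p`) and a
  measurable `B` such that OFF `B` the fibre does not exit `C` within `δ` to the right of a shell point:
  `ν({a ≤ w < b} ∩ C) ≤ M·2(b−a)∕(κδ) · ν({a ≤ w} ∩ C) + ν({a ≤ w < b} ∩ C ∩ B)`
  (`measure_shell_inter_le_of_fibrewise_exit`).
* §4 (knit).  Gibbs-coupled coordinates `ν = e^{−A} dx` with uniform one-sided partial slope `≤ Λ`, tested variables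
  `u_p` ARBITRARY measurable functions of ALL coordinates, each transversal in its own (`y ↦ u_p(x with x_p := y)` has
  slope `≥ κ`), and a measurable `B` covering every fibre exit of every sub-level event:
  `ν{a ≤ ⨆ u < b} ≤ 2e·Λ·(b − a)∕κ · ν{a ≤ ⨆ u} + ν({a ≤ ⨆ u} ∩ B)` (`measure_shell_iSup_gibbs_le_defect`).
* §5 (the cover for weak cross-dependence).  If `|u_q(x with x_p := y) − u_q(x)| ≤ ε·(y − x_p)` for `q ≠ p`,
  `y ≥ x_p` (cross-sensitivity `ε`), then the ONE-SIDED THIN SHELLS `B_η = {∃ q, u_q ∈ [a − η, a) ∪ [b − η, b)}`,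
  `η = ε·Λ⁻¹`, cover every exit (`exit_cover_of_crossLipschitz`): the defect is a DOUBLE-SHELL event (some variable in
  its `ρ`-shell while another is in an `η`-shell), `η∕(θρ) = ε∕(Λθρ)`.

READING FOR THE WALL (hedged; nothing claimed for Bałaban's measure).  The defect is the price of cross-dependence; it
is again an (M1)-type quantity at the THINNER relative width `η∕θ`, so the principle can be iterated (a bootstrap in
the shell width, convergent when `ε ≪ κ`·(shell width ratio)); the iteration and the measurability of concrete exit
events are NOT done here.  Not modelled: group-valued fibres, histories.

HONEST FRAMING.  [textbook] measure theory (Finset induction, Tonelli on a finite product, Lebesgue length of a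
transversal preimage); 0 def, 0 sorry; NE7c NOT PRINTED ∕ NOT proved; N21 NOT discharged; counts unmoved (typed 28∕28 ·
discharged 5∕27); count-neutral; one finite 𝕋⁴ at fixed ε — nothing about ℝ⁴ ∕ OS ∕ mass gap ∕ Clay.
-/

open MeasureTheory Set Function
open scoped ENNReal NNReal

namespace Summit.QuantumFields.YangMills.Theorems.N21FirstExceedanceHazardDefect

open Summit.QuantumFields.YangMills.Theorems.N21FirstExceedanceHazard
  (setOf_shell_iSup_eq_sdiff setOf_le_iSup_eq_iUnion)
open Summit.QuantumFields.YangMills.Theorems.N21HazardFromLogLipschitz (nonCollapse_of_logLipschitz)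
open Summit.QuantumFields.YangMills.Theorems.N21TransversalGibbsHazard
  (setLIntegral_le_of_nonCollapse_into volume_preimage_Ico_le)

/-! ## §1 The first-exceedance induction with a defect event -/

section Core

variable {Ω ι : Type*} [MeasurableSpace Ω] [DecidableEq ι] (ν : Measure Ω) (v : ι → Ω → ℝ) (a b : ℝ)

/-- **THE INDUCTIVE CORE WITH DEFECT.**  As part 7's `measure_sdiff_subLevel_le_of_condHazard`, with the hypothesis
weakened by a defect `ν({a ≤ v p} ∩ {v q < a, q ∈ s} ∩ B)` carried on the FIRST-EXCEEDANCE event of `p` (which is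
disjoint from `⋃_{q∈s}{a ≤ v q}`): the defects accumulate inside `(⋃_{q∈s}{a ≤ v q}) ∩ B`, once. [textbook] -/
theorem measure_sdiff_subLevel_le_of_condHazard_defect (hv : ∀ p, Measurable (v p)) (c : ℝ≥0∞) {B : Set Ω}
    (hB : MeasurableSet B)
    (hhaz : ∀ p (s : Finset ι), p ∉ s →
      ν ({x | a ≤ v p x ∧ v p x < b} ∩ {x | ∀ q, q ≠ p → v q x < if q ∈ s then a else b})
        ≤ c * ν ({x | a ≤ v p x} ∩ {x | ∀ q, q ≠ p → v q x < if q ∈ s then a else b})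
          + ν ({x | a ≤ v p x} ∩ {x | ∀ q ∈ s, v q x < a} ∩ B))
    (s : Finset ι) :
    ν ({x | ∀ q, v q x < b} \ {x | ∀ q, v q x < if q ∈ s then a else b})
      ≤ c * ν (⋃ q ∈ s, {x | a ≤ v q x}) + ν ((⋃ q ∈ s, {x | a ≤ v q x}) ∩ B) := by
  induction s using Finset.induction_on with
  | empty =>
    have h0 : ({x | ∀ q, v q x < b} \ {x : Ω | ∀ q, v q x < if q ∈ (∅ : Finset ι) then a else b}) = ∅ := by
      ext x
      simp only [Finset.notMem_empty, if_false, mem_sdiff, mem_setOf_eq, mem_empty_iff_false, iff_false, not_and,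
        not_not]
      exact fun h => h
    rw [h0, measure_empty]
    exact bot_le
  | insert p s hp ih =>
    set E0 : Set Ω := {x | ∀ q, v q x < b} with hE0
    set Es : Set Ω := {x | ∀ q, v q x < if q ∈ s then a else b} with hEs
    set Eps : Set Ω := {x | ∀ q, v q x < if q ∈ insert p s then a else b} with hEps
    set C : Set Ω := {x | ∀ q, q ≠ p → v q x < if q ∈ s then a else b} with hC
    set A : Set Ω := {x | a ≤ v p x} ∩ {x | ∀ q ∈ s, v q x < a} with hA
    set Gs : Set Ω := ⋃ q ∈ s, {x | a ≤ v q x} with hGs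
    have hGs_meas : MeasurableSet Gs :=
      Finset.measurableSet_biUnion s fun q _ => measurableSet_le measurable_const (hv q)
    have hkey : ∀ q, q ≠ p → ((if q ∈ insert p s then a else b) = if q ∈ s then a else b) := fun q hq => by
      simp only [Finset.mem_insert, hq, false_or]
    -- (1) the new slice is the hazard slice of `p` at `C(p, s)`
    have hslice : Es \ Eps ⊆ {x | a ≤ v p x ∧ v p x < b} ∩ C := by
      rintro x ⟨hxs, hxps⟩
      simp only [hEs, hEps, mem_setOf_eq, not_forall, not_lt] at hxs hxps
      obtain ⟨q, hq⟩ := hxps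
      have hqp : q = p := by
        by_contra hne
        rw [hkey q hne] at hq
        exact absurd (hxs q) (not_lt.2 hq)
      rw [hqp] at hq
      simp only [Finset.mem_insert_self, if_true] at hq
      have hpb : v p x < b := by
        have := hxs p
        rwa [if_neg hp] at this
      exact ⟨⟨hq, hpb⟩, fun q' _ => hxs q'⟩
    have hsplit : E0 \ Eps ⊆ (E0 \ Es) ∪ (Es \ Eps) := by
      rintro x ⟨h0, hn⟩
      by_cases hx : x ∈ Es
      · exact Or.inr ⟨hx, hn⟩
      · exact Or.inl ⟨h0, hx⟩
    -- (2) `F ⊆ A`, `A` disjoint from `Gs`, `Gs ∪ A ⊆ G(insert p s)`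
    have hFA : {x | a ≤ v p x} ∩ C ⊆ A := by
      rintro x ⟨hx, hx'⟩
      refine ⟨hx, fun q hqs => ?_⟩
      have hne : q ≠ p := fun h => hp (h ▸ hqs)
      have := hx' q hne
      rwa [if_pos hqs] at this
    have hdisj : Disjoint Gs A := by
      rw [Set.disjoint_left]
      rintro x hx ⟨-, hx'⟩
      simp only [hGs, mem_iUnion, mem_setOf_eq, exists_prop] at hx
      obtain ⟨q, hqs, hq⟩ := hx
      exact absurd (hx' q hqs) (not_lt.2 hq)
    have hGsub : Gs ∪ A ⊆ ⋃ q ∈ insert p s, {x | a ≤ v q x} := by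
      rintro x (hx | ⟨hx, -⟩)
      · simp only [hGs, mem_iUnion, mem_setOf_eq, exists_prop] at hx ⊢
        obtain ⟨q, hqs, hq⟩ := hx
        exact ⟨q, Finset.mem_insert_of_mem hqs, hq⟩
      · simp only [mem_iUnion, mem_setOf_eq, exists_prop]
        exact ⟨p, Finset.mem_insert_self p s, hx⟩
    have hdisjB : Disjoint (Gs ∩ B) (A ∩ B) :=
      Disjoint.mono inter_subset_left inter_subset_left hdisj
    calc ν (E0 \ Eps) ≤ ν ((E0 \ Es) ∪ (Es \ Eps)) := measure_mono hsplit
      _ ≤ ν (E0 \ Es) + ν (Es \ Eps) := measure_union_le _ _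
      _ ≤ (c * ν Gs + ν (Gs ∩ B)) + (c * ν ({x | a ≤ v p x} ∩ C) + ν (A ∩ B)) :=
          add_le_add ih ((measure_mono hslice).trans (hhaz p s hp))
      _ ≤ (c * ν Gs + ν (Gs ∩ B)) + (c * ν A + ν (A ∩ B)) := by
          gcongr
      _ = c * (ν Gs + ν A) + (ν (Gs ∩ B) + ν (A ∩ B)) := by ring
      _ = c * ν (Gs ∪ A) + ν ((Gs ∪ A) ∩ B) := by
          rw [measure_union' hdisj hGs_meas, union_inter_distrib_right, measure_union' hdisjB (hGs_meas.inter hB)]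
      _ ≤ c * ν (⋃ q ∈ insert p s, {x | a ≤ v q x}) + ν ((⋃ q ∈ insert p s, {x | a ≤ v q x}) ∩ B) := by
          gcongr

variable [Fintype ι] [Nonempty ι]

/-- **THE DEPENDENT HAZARD PRINCIPLE WITH A DEFECT EVENT.**  For ANY measure, ANY finite nonempty family of measurable
tested variables and ANY measurable `B`: conditional windowed hazard bounds up to the defect
`ν({a ≤ v p} ∩ {v q < a on s} ∩ B)` give `ν{a ≤ ⨆ v < b} ≤ c·ν{a ≤ ⨆ v} + ν({a ≤ ⨆ v} ∩ B)`. [textbook] -/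
theorem measure_shell_iSup_le_of_condHazard_defect (hv : ∀ p, Measurable (v p)) (c : ℝ≥0∞) {B : Set Ω}
    (hB : MeasurableSet B)
    (hhaz : ∀ p (s : Finset ι), p ∉ s →
      ν ({x | a ≤ v p x ∧ v p x < b} ∩ {x | ∀ q, q ≠ p → v q x < if q ∈ s then a else b})
        ≤ c * ν ({x | a ≤ v p x} ∩ {x | ∀ q, q ≠ p → v q x < if q ∈ s then a else b})
          + ν ({x | a ≤ v p x} ∩ {x | ∀ q ∈ s, v q x < a} ∩ B)) :
    ν {x | a ≤ (⨆ p, v p x) ∧ (⨆ p, v p x) < b}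
      ≤ c * ν {x | a ≤ ⨆ p, v p x} + ν ({x | a ≤ ⨆ p, v p x} ∩ B) := by
  have h := measure_sdiff_subLevel_le_of_condHazard_defect ν v a b hv c hB hhaz Finset.univ
  simp only [Finset.mem_univ, if_true, iUnion_true] at h
  rw [setOf_shell_iSup_eq_sdiff, setOf_le_iSup_eq_iUnion]
  exact h

end Core

/-! ## §2 Tonelli: fibrewise domination along one coordinate ⇒ domination (general sets) -/

section Fibre

variable {ι : Type*} [Fintype ι] [DecidableEq ι]

/-- **FIBREWISE DOMINATION ⇒ DOMINATION.**  On `ℝ^ι` with `ν = (pi volume).withDensity g`: if along EVERY `p`-fibre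
`∫_{y : (x_p := y) ∈ S} g ≤ c · ∫_{y : (x_p := y) ∈ F} g`, then `ν S ≤ c · ν F` — for ANY measurable `S, F`
(part 9 §1 is the case of sets not reading `x_p`; Tonelli via `lmarginal_erase'`). [textbook] -/
theorem measure_le_of_fibrewise {g : (ι → ℝ) → ℝ≥0∞} (hg : Measurable g) (p : ι) {S F : Set (ι → ℝ)}
    (hS : MeasurableSet S) (hF : MeasurableSet F) (c : ℝ≥0∞) (hc : c ≠ ⊤)
    (hfib : ∀ x : ι → ℝ,
      ∫⁻ y in (update x p) ⁻¹' S, g (update x p y) ≤ c * ∫⁻ y in (update x p) ⁻¹' F, g (update x p y)) :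
    (Measure.pi fun _ : ι => (volume : Measure ℝ)).withDensity g S
      ≤ c * (Measure.pi fun _ : ι => (volume : Measure ℝ)).withDensity g F := by
  have hSi : Measurable (S.indicator g) := hg.indicator hS
  have hFi : Measurable (fun x => c * F.indicator g x) := (hg.indicator hF).const_mul c
  rw [withDensity_apply _ hS, withDensity_apply _ hF, ← lintegral_indicator hS, ← lintegral_indicator hF,
    ← lintegral_const_mul c (hg.indicator hF)]
  classical
  obtain ⟨x₀⟩ : Nonempty (ι → ℝ) := ⟨fun _ => 0⟩
  rw [lintegral_eq_lmarginal_univ x₀, lintegral_eq_lmarginal_univ x₀,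
    lmarginal_erase' (S.indicator g) hSi (Finset.mem_univ p),
    lmarginal_erase' (fun x => c * F.indicator g x) hFi (Finset.mem_univ p)]
  refine lmarginal_mono (fun x => ?_) x₀
  have hS' : ∀ y, S.indicator g (update x p y) = ((update x p) ⁻¹' S).indicator (fun y => g (update x p y)) y := by
    intro y
    by_cases hy : update x p y ∈ S
    · rw [indicator_of_mem hy, indicator_of_mem (show y ∈ (update x p) ⁻¹' S from hy)]
    · rw [indicator_of_notMem hy, indicator_of_notMem (show y ∉ (update x p) ⁻¹' S from hy)]
  have hF' : ∀ y, c * F.indicator g (update x p y)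
      = c * ((update x p) ⁻¹' F).indicator (fun y => g (update x p y)) y := by
    intro y
    by_cases hy : update x p y ∈ F
    · rw [indicator_of_mem hy, indicator_of_mem (show y ∈ (update x p) ⁻¹' F from hy)]
    · rw [indicator_of_notMem hy, indicator_of_notMem (show y ∉ (update x p) ⁻¹' F from hy)]
  simp only [hS', hF']
  rw [lintegral_indicator ((measurable_update x) hS), lintegral_const_mul' _ _ hc,
    lintegral_indicator ((measurable_update x) hF)]
  exact hfib x

/-! ## §3 The fibre with exit: a transversally-read variable, a conditioning event that may read the fibre coordinate,
and a measurable cover of the exits -/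

/-- **THE FIBRE WITH EXIT.**  `ν = (pi volume).withDensity g` on `ℝ^ι`; a tested variable `w` whose reading along the
`p`-fibre has slope `≥ κ > 0`; `g` non-collapsing by `M` within `δ > 0` to the right of every fibre point with
`w ∈ [a, b)` (`a ≤ b`); a measurable conditioning event `C` and a measurable `B` such that OFF `B` the `p`-fibre through
a point of `{a ≤ w < b} ∩ C` stays in `C` for `δ` to the right.  Then
`ν({a ≤ w < b} ∩ C) ≤ M·2(b − a)∕(κδ) · ν({a ≤ w} ∩ C) + ν({a ≤ w < b} ∩ C ∩ B)`. [textbook] -/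
theorem measure_shell_inter_le_of_fibrewise_exit {g : (ι → ℝ) → ℝ≥0∞} (hg : Measurable g) (p : ι)
    {w : (ι → ℝ) → ℝ} (hw : Measurable w) {κ a b δ : ℝ} (hκ : 0 < κ) (hab : a ≤ b) (hδ : 0 < δ) {M : ℝ}
    (hM : 0 ≤ M) (hslope : ∀ x : ι → ℝ, ∀ y₁ y₂, y₁ ≤ y₂ → κ * (y₂ - y₁) ≤ w (update x p y₂) - w (update x p y₁))
    (hnc : ∀ x : ι → ℝ, w x ∈ Ico a b → ∀ y ∈ Icc (x p) (x p + δ), g x ≤ ENNReal.ofReal M * g (update x p y))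
    {C B : Set (ι → ℝ)} (hC : MeasurableSet C) (hB : MeasurableSet B)
    (hexit : ∀ x : ι → ℝ, x ∈ C → x ∉ B → w x ∈ Ico a b → ∀ y ∈ Icc (x p) (x p + δ), update x p y ∈ C) :
    (Measure.pi fun _ : ι => (volume : Measure ℝ)).withDensity g ({x | a ≤ w x ∧ w x < b} ∩ C)
      ≤ ENNReal.ofReal (M * (2 * (b - a) / (κ * δ)))
          * (Measure.pi fun _ : ι => (volume : Measure ℝ)).withDensity g ({x | a ≤ w x} ∩ C)
        + (Measure.pi fun _ : ι => (volume : Measure ℝ)).withDensity g ({x | a ≤ w x ∧ w x < b} ∩ C ∩ B) := by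
  set ν := (Measure.pi fun _ : ι => (volume : Measure ℝ)).withDensity g with hν
  have hSm : MeasurableSet ({x | a ≤ w x ∧ w x < b} ∩ C) :=
    ((measurableSet_le measurable_const hw).inter (measurableSet_lt hw measurable_const)).inter hC
  have hFm : MeasurableSet ({x | a ≤ w x} ∩ C) := (measurableSet_le measurable_const hw).inter hC
  set S := {x | a ≤ w x ∧ w x < b} ∩ C with hS
  -- split off the defect
  have hsplit : S ⊆ (S \ B) ∪ (S ∩ B) := fun x hx => by
    by_cases hxB : x ∈ B
    · exact Or.inr ⟨hx, hxB⟩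
    · exact Or.inl ⟨hx, hxB⟩
  refine ((measure_mono hsplit).trans (measure_union_le _ _)).trans (add_le_add ?_ le_rfl)
  -- the good part: fibrewise non-collapse into `{a ≤ w} ∩ C`
  refine measure_le_of_fibrewise hg p (hSm.diff hB) hFm _ ENNReal.ofReal_ne_top fun x => ?_
  have hwx : Measurable fun y => w (update x p y) := hw.comp (measurable_update x)
  have hgx : Measurable fun y => g (update x p y) := hg.comp (measurable_update x)
  have hS'm : MeasurableSet ((update x p) ⁻¹' (S \ B)) := (measurable_update x) (hSm.diff hB)
  -- (i) right-neighbourhoods of good fibre points stay in the target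
  have hT : ∀ y₁ ∈ (update x p) ⁻¹' (S \ B), Icc y₁ (y₁ + δ) ⊆ (update x p) ⁻¹' ({x | a ≤ w x} ∩ C) := by
    intro y₁ hy₁ y₂ hy₂
    obtain ⟨⟨⟨ha, hb⟩, hC₁⟩, hB₁⟩ := hy₁
    have hy₂' : y₂ ∈ Icc ((update x p y₁) p) ((update x p y₁) p + δ) := by simpa using hy₂
    have hstay := hexit (update x p y₁) hC₁ hB₁ ⟨ha, hb⟩ y₂ hy₂'
    rw [update_idem] at hstay
    refine ⟨?_, hstay⟩
    have h1 := hslope x y₁ y₂ hy₂.1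
    have h2 : 0 ≤ κ * (y₂ - y₁) := mul_nonneg hκ.le (by linarith [hy₂.1])
    show a ≤ w (update x p y₂)
    linarith
  -- (ii) non-collapse along the fibre at good points
  have hnc' : ∀ y₁ ∈ (update x p) ⁻¹' (S \ B), ∀ y₂ ∈ Icc y₁ (y₁ + δ),
      g (update x p y₁) ≤ ENNReal.ofReal M * g (update x p y₂) := by
    intro y₁ hy₁ y₂ hy₂
    obtain ⟨⟨⟨ha, hb⟩, -⟩, -⟩ := hy₁
    have hy₂' : y₂ ∈ Icc ((update x p y₁) p) ((update x p y₁) p + δ) := by simpa using hy₂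
    have := hnc (update x p y₁) ⟨ha, hb⟩ y₂ hy₂'
    rwa [update_idem] at this
  have h1 := setLIntegral_le_of_nonCollapse_into hgx hS'm hδ (ENNReal.ofReal M) hT hnc'
  refine h1.trans (mul_le_mul_left ?_ _)
  -- (iii) the good fibre set is a transversal shell preimage: length `≤ 2(b − a)/κ`
  have hsub : (update x p) ⁻¹' (S \ B) ⊆ (fun y => w (update x p y)) ⁻¹' Ico a b :=
    fun y hy => hy.1.1
  have hvol : volume ((update x p) ⁻¹' (S \ B)) ≤ ENNReal.ofReal (2 * (b - a) / κ) :=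
    (measure_mono hsub).trans (volume_preimage_Ico_le hκ (fun y₁ y₂ h => hslope x y₁ y₂ h) a b)
  have h2 : 0 ≤ 2 * (b - a) / κ := div_nonneg (by linarith) hκ.le
  calc ENNReal.ofReal M * (volume ((update x p) ⁻¹' (S \ B)) * (ENNReal.ofReal δ)⁻¹)
      ≤ ENNReal.ofReal M * (ENNReal.ofReal (2 * (b - a) / κ) * (ENNReal.ofReal δ)⁻¹) := by gcongr
    _ = ENNReal.ofReal (M * (2 * (b - a) / (κ * δ))) := by
        rw [← ENNReal.ofReal_inv_of_pos hδ, ← ENNReal.ofReal_mul h2, ← ENNReal.ofReal_mul hM]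
        congr 1
        field_simp

end Fibre

/-! ## §4 Knit: cross-dependent, transversally-read Gibbs variables — (M1) up to the double-shell defect -/

section Knit

variable {ι : Type*} [Fintype ι] [DecidableEq ι] [Nonempty ι]

/-- **(M1) FOR THE BLOCK-SUP OF CROSS-DEPENDENT GIBBS VARIABLES, UP TO THE DEFECT.**  `ν = e^{−A(x)} dx` on `ℝ^ι`;
tested variables `u_p : ℝ^ι → ℝ`, ARBITRARY measurable functions of ALL coordinates, each read transversally along its
own coordinate (slope `≥ κ > 0`); one-sided partial slope of `A` along `x_p` at most `Λ > 0` on the right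
`Λ⁻¹`-neighbourhoods of `u_p`'s shell points, uniformly in the rest; `B` measurable covering every fibre exit of every
sub-level event of the other variables.  Then
`ν{a ≤ ⨆ u < b} ≤ 2e·Λ·(b − a)∕κ · ν{a ≤ ⨆ u} + ν({a ≤ ⨆ u} ∩ B)`. [textbook] -/
theorem measure_shell_iSup_gibbs_le_defect {A : (ι → ℝ) → ℝ} (hA : Measurable A) {u : ι → (ι → ℝ) → ℝ}
    (hu : ∀ p, Measurable (u p)) {κ Λ a b : ℝ} (hκ : 0 < κ) (hΛ : 0 < Λ) (hab : a ≤ b)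
    (hslopeU : ∀ p (x : ι → ℝ) (y₁ y₂ : ℝ), y₁ ≤ y₂ → κ * (y₂ - y₁) ≤ u p (update x p y₂) - u p (update x p y₁))
    (hslopeA : ∀ p (x : ι → ℝ), u p x ∈ Ico a b → ∀ y ∈ Icc (x p) (x p + Λ⁻¹),
      A (update x p y) - A x ≤ Λ * (y - x p))
    {B : Set (ι → ℝ)} (hB : MeasurableSet B)
    (hexit : ∀ p (t : ι → ℝ), (∀ q, t q = a ∨ t q = b) → ∀ x : ι → ℝ, (∀ q, q ≠ p → u q x < t q) → x ∉ B →
      u p x ∈ Ico a b → ∀ y ∈ Icc (x p) (x p + Λ⁻¹), ∀ q, q ≠ p → u q (update x p y) < t q) :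
    (Measure.pi fun _ : ι => (volume : Measure ℝ)).withDensity (fun x => ENNReal.ofReal (Real.exp (-A x)))
        {x | a ≤ (⨆ p, u p x) ∧ (⨆ p, u p x) < b}
      ≤ ENNReal.ofReal (2 * Real.exp 1 * Λ * (b - a) / κ)
          * (Measure.pi fun _ : ι => (volume : Measure ℝ)).withDensity (fun x => ENNReal.ofReal (Real.exp (-A x)))
            {x | a ≤ ⨆ p, u p x}
        + (Measure.pi fun _ : ι => (volume : Measure ℝ)).withDensity (fun x => ENNReal.ofReal (Real.exp (-A x)))
            ({x | a ≤ ⨆ p, u p x} ∩ B) := by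
  have hg : Measurable fun x : ι → ℝ => ENNReal.ofReal (Real.exp (-A x)) :=
    ENNReal.measurable_ofReal.comp (Real.measurable_exp.comp hA.neg)
  refine measure_shell_iSup_le_of_condHazard_defect _ u a b hu _ hB fun p s hps => ?_
  set t : ι → ℝ := fun q => if q ∈ s then a else b with ht
  have htab : ∀ q, t q = a ∨ t q = b := fun q => by
    by_cases hq : q ∈ s
    · exact Or.inl (if_pos hq)
    · exact Or.inr (if_neg hq)
  have hC : MeasurableSet {x : ι → ℝ | ∀ q, q ≠ p → u q x < t q} := by
    have : {x : ι → ℝ | ∀ q, q ≠ p → u q x < t q} = ⋂ q, {x | q ≠ p → u q x < t q} := by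
      ext x; simp only [mem_setOf_eq, mem_iInter]
    rw [this]
    refine MeasurableSet.iInter fun q => ?_
    by_cases hq : q = p
    · have : {x : ι → ℝ | q ≠ p → u q x < t q} = univ := by
        ext x; simp [hq]
      rw [this]; exact MeasurableSet.univ
    · have : {x : ι → ℝ | q ≠ p → u q x < t q} = {x | u q x < t q} := by
        ext x; simp [hq]
      rw [this]; exact measurableSet_lt (hu q) measurable_const
  -- non-collapse of `e^{−A}` along the fibre from the one-sided slope bound
  have hnc : ∀ x : ι → ℝ, u p x ∈ Ico a b → ∀ y ∈ Icc (x p) (x p + Λ⁻¹),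
      ENNReal.ofReal (Real.exp (-A x))
        ≤ ENNReal.ofReal (Real.exp 1) * ENNReal.ofReal (Real.exp (-A (update x p y))) := by
    intro x hx y hy
    rw [← ENNReal.ofReal_mul (Real.exp_pos _).le, ← Real.exp_add]
    refine ENNReal.ofReal_le_ofReal (Real.exp_le_exp.2 ?_)
    have h1 := hslopeA p x hx y hy
    have h2 : Λ * (y - x p) ≤ Λ * Λ⁻¹ := mul_le_mul_of_nonneg_left (by linarith [hy.2]) hΛ.le
    rw [mul_inv_cancel₀ hΛ.ne'] at h2
    linarith
  have h := measure_shell_inter_le_of_fibrewise_exit hg p (hu p) hκ hab (inv_pos.2 hΛ) (Real.exp_pos 1).le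
    (hslopeU p) hnc hC hB (fun x hxC hxB hx y hy => hexit p t htab x hxC hxB hx y hy)
  -- the defect of the slice sits inside `{a ≤ u p} ∩ {u q < a, q ∈ s} ∩ B`
  have hdef : {x : ι → ℝ | a ≤ u p x ∧ u p x < b} ∩ {x | ∀ q, q ≠ p → u q x < t q} ∩ B
      ⊆ {x | a ≤ u p x} ∩ {x | ∀ q ∈ s, u q x < a} ∩ B := by
    rintro x ⟨⟨⟨hxa, -⟩, hxC⟩, hxB⟩
    refine ⟨⟨hxa, fun q hqs => ?_⟩, hxB⟩
    have hne : q ≠ p := fun hqp => hps (hqp ▸ hqs)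
    have := hxC q hne
    simp only [ht, if_pos hqs] at this
    exact this
  refine h.trans (add_le_add (le_of_eq ?_) (measure_mono hdef))
  congr 2
  rw [show κ * Λ⁻¹ = κ / Λ by rw [div_eq_mul_inv]]
  field_simp

end Knit

/-! ## §5 The exit cover for weak cross-dependence: one-sided thin shells below the two thresholds -/

section Cover

variable {ι : Type*} [DecidableEq ι]

/-- **ONE-SIDED THIN SHELLS COVER EVERY EXIT.**  If the other tested variables are `ε`-Lipschitz along the `p`-fibre to
the right (`u_q(x with x_p := y) ≤ u_q(x) + ε(y − x_p)` for `q ≠ p`, `x_p ≤ y`), then off the event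
`B = {∃ q, u_q ∈ [a − εδ, a) ∪ [b − εδ, b)}` no sub-level event `{u_q < t_q, q ≠ p}` with `t_q ∈ {a, b}` is exited
within `δ` to the right: the hypothesis `hexit` of §4 with `δ = Λ⁻¹`. [textbook] -/
theorem exit_cover_of_crossLipschitz {u : ι → (ι → ℝ) → ℝ} {ε δ a b : ℝ} (hε : 0 ≤ ε)
    (hcross : ∀ p q, q ≠ p → ∀ (x : ι → ℝ) (y : ℝ), x p ≤ y → u q (update x p y) ≤ u q x + ε * (y - x p))
    (p : ι) (t : ι → ℝ) (ht : ∀ q, t q = a ∨ t q = b) (x : ι → ℝ) (hxC : ∀ q, q ≠ p → u q x < t q)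
    (hxB : x ∉ {x : ι → ℝ | ∃ q, (a - ε * δ ≤ u q x ∧ u q x < a) ∨ (b - ε * δ ≤ u q x ∧ u q x < b)})
    {y : ℝ} (hy : y ∈ Icc (x p) (x p + δ)) (q : ι) (hq : q ≠ p) :
    u q (update x p y) < t q := by
  have h1 := hcross p q hq x y hy.1
  have h2 : ε * (y - x p) ≤ ε * δ := mul_le_mul_of_nonneg_left (by linarith [hy.2]) hε
  have hlt := hxC q hq
  -- off `B`, `u q x` is below `t q − εδ`
  have hfar : u q x < t q - ε * δ := by
    by_contra hge
    rw [not_lt] at hge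
    apply hxB
    simp only [mem_setOf_eq]
    rcases ht q with htq | htq
    · exact ⟨q, Or.inl ⟨by rw [htq] at hge; exact hge, by rw [htq] at hlt; exact hlt⟩⟩
    · exact ⟨q, Or.inr ⟨by rw [htq] at hge; exact hge, by rw [htq] at hlt; exact hlt⟩⟩
  linarith

end Cover

end Summit.QuantumFields.YangMills.Theorems.N21FirstExceedanceHazardDefect
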